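import Summits.HubbardSuperconductivity.HubbardSuperconductivity.Theorems.ThermalWedgeTwTipContinuationEdgeOrder
import Summits.HubbardSuperconductivity.HubbardSuperconductivity.Theorems.DeformationLadderDeformedRungCooperLog
import Summits.HubbardSuperconductivity.HubbardSuperconductivity.Theorems.DeformationLadderDeformedRungTuning

/-!
# `DeformedRung` (stmt-HubbardSuperconductivity-1894, route `DeformationLadder`) — piece 3:
# the extensive gap of the `U = 0` reduced d-wave BCS torus at EVERY doping `δ ∈ (0,1/2)` and
# EVERY side `L`

`extensiveGap_all`: for `δ ∈ (0,1/2)` and `c > 0` there is `κ > 0` with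
`κ L² ≤ E_L(0,0) − E_L(0,c)` eventually in `L` (all parities), where
`E_L(U,g) = minEnergyOn (hubbardTorus 2 L 1 U − (g/L²) P_L) (szSector (2⌊(1−δ)L²/2⌋) 0)`,
`P_L = (pairField d L)ᴴ (pairField d L)`. This is `extensiveGap` of
Theorems/ThermalWedgeTwTipContinuationEdgeOrder.lean (BCS trial state + Cooper logarithm + sector
transfer: `gap_at_side`, `budget_arith`) with its two parity/doping-specific inputs replaced by the
every-side Cooper bound below the ceiling `μ ≤ s²/4` (`exists_gap_cooperLog_all`) and the
every-filling tuning `exists_mu_of_target_all` (ceiling `β = s²/4`, `s = 3/10`, deficit `η = δ`,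
gap buffer capped by `βδ/4` so that `10D² ≤ δβ²`). Folklore (BCS 1957; Bogoliubov 1958; Leggett,
*Quantum Liquids* (2006) §5.4).
-/

noncomputable section

namespace Summit.HubbardSuperconductivity.DeformationLadder.DeformedRung

open Matrix Filter Finset
open Literature.MathematicalPhysics.QuantumLattice Literature.Probability.LatticeModels
open Summit.HubbardSuperconductivity.TwTipContinuation.Negative
open Summit.HubbardSuperconductivity.TwTipContinuation.IsogapTransport
open scoped ComplexOrder

/-- **The extensive gap at the `U = 0` edge, every doping and every side.** For `δ ∈ (0,1/2)` and
`c > 0` there is `κ > 0` such that, eventually in `L` (odd `L` included),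
`κ L² ≤ E_L(0,0) − E_L(0,c)` in the canonical sector `(2⌊(1−δ)L²/2⌋, S^z = 0)`. [folklore] -/
theorem extensiveGap_all (δ : ℝ) (hδ : δ ∈ Set.Ioo (0 : ℝ) (1 / 2)) (c : ℝ) (hc : 0 < c) :
    ∃ κ : ℝ, 0 < κ ∧ ∃ L₀ : ℕ, ∀ (L : ℕ) [NeZero L], L₀ ≤ L →
      κ * (L : ℝ) ^ 2 ≤
        (Matrix.minEnergyOn (hubbardTorus 2 L 1 0) (szSector (2 * ⌊(1 - δ) * (L : ℝ) ^ 2 / 2⌋₊) 0))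
          - (Matrix.minEnergyOn (hubbardTorus 2 L 1 0 - ((c / (L : ℝ) ^ 2 : ℝ) : ℂ) • ((pairField dWaveFormFactor L)ᴴ * pairField dWaveFormFactor L)) (szSector (2 * ⌊(1 - δ) * (L : ℝ) ^ 2 / 2⌋₊) 0)) := by
  obtain ⟨hδ1, hδ2⟩ := hδ
  -- ceiling `β = s²/4 = 9/400` (`s = 3/10`); gap buffer capped by `βδ/4`, so that `10D² ≤ δβ²`
  obtain ⟨D, hD, hDcap, hD100, L₁, hcoop⟩ := exists_gap_cooperLog_all (s := 3 / 10) (by norm_num) (by norm_num)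
    (max 2 (1 / (4 * c))) (D₁ := 9 / 400 * δ / 4) (by positivity)
  have hD1 : D ≤ 1 := hD100.trans (by norm_num)
  have hDβ : 10 * D ^ 2 ≤ δ * (9 / 400 : ℝ) ^ 2 := by
    have h1 : D ^ 2 ≤ (9 / 400 * δ / 4) ^ 2 := pow_le_pow_left₀ hD.le hDcap 2
    have h2 : δ ^ 2 ≤ δ := by nlinarith
    nlinarith
  set Cd := (∑ e ∈ insert 0 unitSteps, ‖((dWaveFormFactor e / Real.sqrt 2 : ℝ) : ℂ)‖ * 2) ^ 2 with hCd
  have hCd0 : 0 ≤ Cd := by positivity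
  set C₀ : ℝ := 8 + c * (Cd / 2 + 256) with hC₀
  set B₂ : ℝ := 16 + c * Cd with hB₂
  set K : ℝ := B₂ / D ^ 2 + 1 with hK
  have hK1 : 1 ≤ K := by rw [hK]; exact le_add_of_nonneg_left (by positivity)
  have hK0 : 0 ≤ K := by linarith
  have hKB : B₂ / D ^ 2 ≤ K := by rw [hK]; linarith
  obtain ⟨L₂, htune⟩ := exists_mu_of_target_all hD hD1 (by norm_num : (0 : ℝ) < 9 / 400) hδ1
    (by linarith : δ ≤ 1) hDβ hK0
  set Λ₁ : ℝ := (38 / 5) * K + C₀ * (3 / 4 + K ^ 2) with hΛ₁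
  refine ⟨D ^ 2 / 2, by positivity, max L₁ (max L₂ (max 3 ⌈4 * Λ₁ / D ^ 2⌉₊)), fun L _ hL => ?_⟩
  have hL₁ : L₁ ≤ L := (le_max_left _ _).trans hL
  have hL₂ : L₂ ≤ L := ((le_max_left _ _).trans (le_max_right _ _)).trans hL
  have hL3 : 3 ≤ L := (((le_max_left _ _).trans (le_max_right _ _)).trans (le_max_right _ _)).trans hL
  have hLbig : 4 * Λ₁ / D ^ 2 ≤ (L : ℝ) :=
    (Nat.ceil_le.1 ((((le_max_right _ _).trans (le_max_right _ _)).trans (le_max_right _ _)).trans hL))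
  have hLr : (0 : ℝ) < L := by exact_mod_cast (show 0 < L by omega)
  have hL2pos : (0 : ℝ) < (L : ℝ) ^ 2 := by positivity
  -- the sector and the target mean number
  set n : ℕ := ⌊(1 - δ) * (L : ℝ) ^ 2 / 2⌋₊ with hn
  have hx0 : 0 ≤ (1 - δ) * (L : ℝ) ^ 2 / 2 := by
    have : 0 ≤ 1 - δ := by linarith
    positivity
  have hnle : (n : ℝ) ≤ (1 - δ) * (L : ℝ) ^ 2 / 2 := Nat.floor_le hx0
  have hnge : (1 - δ) * (L : ℝ) ^ 2 / 2 < n + 1 := Nat.lt_floor_add_one _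
  have hδL0 : 0 ≤ δ * (L : ℝ) ^ 2 := by positivity
  have hδL : δ * (L : ℝ) ^ 2 ≤ 1 / 2 * (L : ℝ) ^ 2 := mul_le_mul_of_nonneg_right hδ2.le hL2pos.le
  have hn2 : 2 * (n : ℝ) ≤ (L : ℝ) ^ 2 := by linarith
  set t : ℝ := 2 * n - 2 * K * L with ht
  have hKL : 0 ≤ 2 * K * (L : ℝ) := by positivity
  have ht1 : (L : ℝ) ^ 2 / 2 - 2 * K * L - 2 ≤ t := by rw [ht]; linarith
  have ht2 : t ≤ (1 - δ) * (L : ℝ) ^ 2 := by rw [ht]; linarith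
  obtain ⟨μ, hμa, hμb, hocc⟩ := htune L hL₂ t ht1 ht2
  clear htune
  -- the Cooper bound at the tuned chemical potential (`−3.82 ≤ −3.75 − 4D ≤ μ ≤ 9/400 = s²/4`)
  have hμ1 : -4 + 2 * (3 / 10 : ℝ) ^ 2 ≤ μ := by
    have : (-4 : ℝ) + 2 * (3 / 10) ^ 2 ≤ -15 / 4 - 4 * D := by
      norm_num
      linarith [hD100]
    linarith
  have hμ2 : μ ≤ (3 / 10 : ℝ) ^ 2 / 4 := by norm_num; exact hμb
  have hμabs : |μ| ≤ 19 / 5 := by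
    rw [abs_le]
    constructor
    · linarith [hμa, hD100]
    · linarith [hμb]
  have hS := hcoop L hL₁ μ hμ1 hμ2
  clear hcoop
  set S := ∑ k : TorusSite 2 L, dWaveGap k ^ 2 /
    (2 * Real.sqrt ((torusBand L k - μ) ^ 2 + D ^ 2 * dWaveGap k ^ 2 + D ^ 4)) with hSdef
  rw [le_inv_mul_iff₀ hL2pos] at hS
  have hS1 : 2 * (L : ℝ) ^ 2 ≤ S :=
    calc 2 * (L : ℝ) ^ 2 = (L : ℝ) ^ 2 * 2 := by ring
      _ ≤ (L : ℝ) ^ 2 * max 2 (1 / (4 * c)) := mul_le_mul_of_nonneg_left (le_max_left _ _) hL2pos.le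
      _ ≤ S := hS
  have hS2 : (L : ℝ) ^ 2 ≤ 4 * c * S := by
    have h := (mul_le_mul_of_nonneg_left (le_max_right (2 : ℝ) (1 / (4 * c))) hL2pos.le).trans hS
    rw [show (L : ℝ) ^ 2 * (1 / (4 * c)) = (L : ℝ) ^ 2 / (4 * c) by ring, div_le_iff₀ (by positivity)] at h
    linarith
  -- the side estimate
  have hgt : ∑ k : TorusSite 2 L, (1 - (torusBand L k - μ) /
      Real.sqrt ((torusBand L k - μ) ^ 2 + D ^ 2 * dWaveGap k ^ 2 + D ^ 4)) < 2 * n := by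
    rw [hocc, ht]
    have : 0 < 2 * K * (L : ℝ) := by positivity
    linarith
  have hside := gap_at_side hL3 hc hD hn2 hS1 hS2 hgt
  rw [hocc] at hside
  have hg : 2 * (n : ℝ) - t = 2 * K * L := by rw [ht]; ring
  have hbud := budget_arith (C₀ := C₀) (B₂ := B₂) hD hLr hK1 hKB hμabs hg (by rw [hΛ₁] at hLbig; exact hLbig)
  rw [← hCd, ← hC₀, ← hB₂] at hside
  linarith

end Summit.HubbardSuperconductivity.DeformationLadder.DeformedRung
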